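import Summits.BirchSwinnertonDyer.BirchSwinnertonDyer.Theorems.ErratumRoadFiveSigmaLocalGoodFrobenius
import Literature.NumberTheory.EllipticCurves.HasseWeilAbelianCoinvariantsProofs
import Literature.NumberTheory.EllipticCurves.HasseWeilAbelianEulerFactorEllipticProofs
import Literature.NumberTheory.EllipticCurves.HasseWeilAbelianEulerFactorEllipticSplitProofs
import Literature.NumberTheory.EllipticCurves.InertiaInvariantsMultiplicativeProofs
import Literature.NumberTheory.EllipticCurves.TateModuleContinuityProofs
import Literature.NumberTheory.EllipticCurves.TateModuleFixedPointsProofs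
import Literature.NumberTheory.EllipticCurves.TateModuleProjSurjectiveProofs
import HarnessLib

/-!
# (S5-mult) inputs: at a MULTIPLICATIVE place `w ∤ p` the local inertia group acts on `E[p^∞]`
# through `(σ − 1)(τ − 1) = 0`, non-trivially, and Frobenius acts on the inertia coinvariants of
# `T_p E` as `ε = ±1` up to the coinvariant kernel (theorems only)

Cell `bsd-stepL`, K2 route `ErratumRoadFive`, support item 20495 `JSWSigmaLocalCharIdeal`, step (S5) of
the L5 plan at the finitely decomposed places of MULTIPLICATIVE reduction; seat `bsd-stepL-imc-p1` (g14).
THEOREMS ONLY (no definition, no named fact, no `sorry`).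

All statements are read off three DISCHARGED facts of the tree on the rational Tate module
`V_p E = ℚ_p ⊗ T_p E` at the prime `𝔓₀ = adicCompletionPrime K w` (whose inertia ∕ decomposition
groups are the images of `absInertia K_w ≤ Γ_{K_w}` under `localMap K (inl w)`):
`codimFixed_inertia_rationalTate_eq_one_of_hasMultiplicativeReductionAt_holds` (`dim (V_pE)^{I} = 1`),
`det_restrictDecomposition_inertia_eq_one` (inertia has determinant `1`) — whence by
`Coinvariants.ker_eq_invariants_of_finrank_invariants_eq_one` the inertia acts unipotently,
`⟨τv − v⟩ = (V_pE)^{I}` — and `inertiaCoinvariants_rationalTate_of_has[Non]splitMultiplicativeReductionAt_holds`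
(an arithmetic Frobenius acts on `(V_pE)_{I}` as `+1` ∕ `−1`).

* §1 (global `𝔓 ∣ w`): `rationalTate_inertia_sub_mem_fixedSubmodule` — `ρ(τ)v − v ∈ (V_pE)^{I_𝔓}` for
  `τ ∈ I_𝔓`; `rationalTate_frob_sub_smul_mem_coinvariantsKer` — `ρ(σ)v − ε v ∈ ker(V → V_{I_𝔓})`.
* §2 (local currency, `T_p E` and `E[p^∞]`): `tateModule_inertia_smul_sub_smul_sub`,
  `primaryTorsionGaloisRep_inertia_comm_sub` (`(τ−1)(σ−1) = 0` for `σ, τ ∈ absInertia K_w`),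
  `exists_absInertia_primaryTorsionGaloisRep_ne` (inertia acts non-trivially on `E[p^∞]`),
  `exists_pow_smul_frob_sub_smul_mem_span` (for a local Frobenius `φ`: some `p^m • (φx − εx)` lies in
  the `ℤ_p`-span of `{τy − y : τ ∈ I_w, y ∈ T_pE}`).

References: [SilvermanATAEC1994] Thm. IV.10.2(a), Ex. 5.13; [SerreTate1968] §3; [GreenbergVatsal2000]
§2, proof of Prop. 2.4 (arXiv p. 22).
-/

noncomputable section

open scoped Classical TensorProduct
open Polynomial Field NumberField IsDedekindDomain WeierstrassCurve Module
open Literature.NumberTheory.EllipticCurves Literature.NumberTheory.GaloisRepresentations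
  Literature.NumberTheory.EllipticCurves.BigGaloisRep
  Literature.NumberTheory.GaloisRepresentations.IsNonarchimedeanLocalField

set_option autoImplicit false
-- the Theorems namespace of this sub repeats the summit name by design (D-0017 nested layout)
set_option linter.dupNamespace false

namespace Summit.BirchSwinnertonDyer.BirchSwinnertonDyer.Theorems.SigmaLocal

/-! ## §1 The rational Tate module at a prime `𝔓 ∣ w` of multiplicative reduction -/

section Rational

variable {K : Type} [Field K] [NumberField K] (E : WeierstrassCurve K) [E.IsElliptic]
  (p : ℕ) [Fact p.Prime] {w : HeightOneSpectrum (𝓞 K)}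

/-- `dim (V_pE)^{I_𝔓} = 1` at a multiplicative `𝔓 ∣ w ∤ p`, as the finrank of the invariants of the
inertia restriction of `ρ|_{D_𝔓}` (the representation whose coinvariants are `InertiaCoinvariants`).
[cite: SilvermanATAEC1994, Thm. IV.10.2(a) (multiplicative case)] -/
theorem finrank_invariants_restrictDecomposition_inertia_eq_one
    (hw : ((p : ℕ) : 𝓞 K) ∉ w.asIdeal) (hv : E.HasMultiplicativeReductionAt w)
    {𝔓 : Ideal (absIntegers (𝓞 K) K)} (h𝔓 : 𝔓 ∈ w.primesAbove) :
    finrank ℚ_[p] (Representation.invariants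
      (((rationalTateGaloisRepOf (geomPoints E) p (continuous_rationalGaloisRepTate_holds E p)).restrictDecomposition 𝔓).comp
        (𝔓.inertia (𝔓.decompositionSubgroup (absoluteGaloisGroup K))).subtype)) = 1 := by
  haveI : FiniteDimensional ℚ_[p] (RationalTateModule (geomPoints E) p) := finite_rationalTateModule E p
  have hcodim := E.codimFixed_inertia_rationalTate_eq_one_of_hasMultiplicativeReductionAt_holds p
    (continuous_rationalGaloisRepTate_holds E p) w hw hv h𝔓
  rw [ContinuousRep.invariants_restrictDecomposition_comp_inertia]
  have hsub := (rationalTateGaloisRepOf (geomPoints E) p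
    (continuous_rationalGaloisRepTate_holds E p)).codimFixed_eq_finrank_sub (𝔓.inertia (absoluteGaloisGroup K))
  rw [hcodim, E.finrank_rationalTateModule_geomPoints_eq_two p] at hsub
  have := Submodule.finrank_le ((rationalTateGaloisRepOf (geomPoints E) p
    (continuous_rationalGaloisRepTate_holds E p)).fixedSubmodule (𝔓.inertia (absoluteGaloisGroup K)))
  rw [E.finrank_rationalTateModule_geomPoints_eq_two p] at this
  omega

/-- **The coinvariant kernel is the invariant line**: at a multiplicative `𝔓 ∣ w ∤ p`,
`⟨ρ(τ)v − v : τ ∈ I_𝔓⟩ = (V_pE)^{I_𝔓}` (inertia acts with determinant `1` on a plane whose invariants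
form a line). [cite: SilvermanATAEC1994, Ex. 5.13 (b) (inertia acts through `(1 *; 0 1)`)] -/
theorem coinvariantsKer_rationalTate_eq_fixedSubmodule
    (hw : ((p : ℕ) : 𝓞 K) ∉ w.asIdeal) (hv : E.HasMultiplicativeReductionAt w)
    {𝔓 : Ideal (absIntegers (𝓞 K) K)} (h𝔓 : 𝔓 ∈ w.primesAbove) :
    Representation.Coinvariants.ker
      (((rationalTateGaloisRepOf (geomPoints E) p (continuous_rationalGaloisRepTate_holds E p)).restrictDecomposition 𝔓).comp
        (𝔓.inertia (𝔓.decompositionSubgroup (absoluteGaloisGroup K))).subtype) =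
      (rationalTateGaloisRepOf (geomPoints E) p (continuous_rationalGaloisRepTate_holds E p)).fixedSubmodule
        (𝔓.inertia (absoluteGaloisGroup K)) := by
  haveI : FiniteDimensional ℚ_[p] (RationalTateModule (geomPoints E) p) := finite_rationalTateModule E p
  rw [← ContinuousRep.invariants_restrictDecomposition_comp_inertia]
  exact Representation.Coinvariants.ker_eq_invariants_of_finrank_invariants_eq_one _
    (E.finrank_rationalTateModule_geomPoints_eq_two p)
    (fun s ↦ E.det_restrictDecomposition_inertia_eq_one p (continuous_rationalGaloisRepTate_holds E p) hw h𝔓 s)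
    (finrank_invariants_restrictDecomposition_inertia_eq_one E p hw hv h𝔓)

/-- **`ρ(τ)v − v` is inertia-fixed** for `τ ∈ I_𝔓`, `v ∈ V_pE`, at a multiplicative `𝔓 ∣ w ∤ p`
(`(σ − 1)(τ − 1) = 0` on `V_pE` for `σ, τ ∈ I_𝔓`). [cite: SilvermanATAEC1994, Ex. 5.13 (b)] -/
theorem rationalTate_inertia_smul_sub_eq
    (hw : ((p : ℕ) : 𝓞 K) ∉ w.asIdeal) (hv : E.HasMultiplicativeReductionAt w)
    {𝔓 : Ideal (absIntegers (𝓞 K) K)} (h𝔓 : 𝔓 ∈ w.primesAbove)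
    {σ τ : absoluteGaloisGroup K} (hσ : σ ∈ 𝔓.inertia (absoluteGaloisGroup K))
    (hτ : τ ∈ 𝔓.inertia (absoluteGaloisGroup K)) (v : RationalTateModule (geomPoints E) p) :
    rationalTateRepresentation (absoluteGaloisGroup K) (geomPoints E) p σ
        (rationalTateRepresentation (absoluteGaloisGroup K) (geomPoints E) p τ v - v) =
      rationalTateRepresentation (absoluteGaloisGroup K) (geomPoints E) p τ v - v := by
  have hmem : rationalTateRepresentation (absoluteGaloisGroup K) (geomPoints E) p τ v - v ∈
      (rationalTateGaloisRepOf (geomPoints E) p (continuous_rationalGaloisRepTate_holds E p)).fixedSubmodule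
        (𝔓.inertia (absoluteGaloisGroup K)) := by
    rw [← coinvariantsKer_rationalTate_eq_fixedSubmodule E p hw hv h𝔓]
    exact Representation.Coinvariants.sub_mem_ker
      (⟨⟨τ, Ideal.inertia_le_decompositionSubgroup (absoluteGaloisGroup K) 𝔓 hτ⟩,
        Ideal.coe_mem_inertia.mp hτ⟩ : 𝔓.inertia (𝔓.decompositionSubgroup (absoluteGaloisGroup K))) v
  exact ((ContinuousRep.mem_fixedSubmodule _ _ _).mp hmem) σ hσ

/-- **Frobenius acts on the inertia coinvariants as `ε`** at a multiplicative `𝔓 ∣ w ∤ p`: for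
`σ ∈ D_𝔓` an arithmetic Frobenius, `ρ(σ)v − ε • v ∈ ⟨ρ(τ)v' − v' : τ ∈ I_𝔓⟩` with `ε = 1` at a split,
`ε = −1` at a non-split multiplicative place (the tree's DISCHARGED
`inertiaCoinvariants_rationalTate_of_has[Non]splitMultiplicativeReductionAt_holds`).
[cite: SilvermanATAEC1994, Thm. V.5.3, Lemma V.5.2 (c), Ex. 5.11 (b), Ex. 5.13 (a)] -/
theorem rationalTate_frob_sub_smul_mem_coinvariantsKer
    (hw : ((p : ℕ) : 𝓞 K) ∉ w.asIdeal) (hv : E.HasMultiplicativeReductionAt w)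
    {𝔓 : Ideal (absIntegers (𝓞 K) K)} (h𝔓 : 𝔓 ∈ w.primesAbove)
    {σ : absoluteGaloisGroup K} (hσD : σ ∈ 𝔓.decompositionSubgroup (absoluteGaloisGroup K))
    (hσ : IsArithFrobAt (𝓞 K) σ 𝔓) {ε : ℚ_[p]}
    (hε : (E.HasSplitMultiplicativeReductionAt w ∧ ε = 1) ∨
      (¬ E.HasSplitMultiplicativeReductionAt w ∧ ε = -1))
    (v : RationalTateModule (geomPoints E) p) :
    rationalTateRepresentation (absoluteGaloisGroup K) (geomPoints E) p σ v - ε • v ∈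
      Representation.Coinvariants.ker
        (((rationalTateGaloisRepOf (geomPoints E) p (continuous_rationalGaloisRepTate_holds E p)).restrictDecomposition 𝔓).comp
          (𝔓.inertia (𝔓.decompositionSubgroup (absoluteGaloisGroup K))).subtype) := by
  set π := ((rationalTateGaloisRepOf (geomPoints E) p
      (continuous_rationalGaloisRepTate_holds E p)).restrictDecomposition 𝔓).comp
    (𝔓.inertia (𝔓.decompositionSubgroup (absoluteGaloisGroup K))).subtype with hπ
  -- the scalar on the coinvariants
  have hscal : (rationalTateGaloisRepOf (geomPoints E) p
      (continuous_rationalGaloisRepTate_holds E p)).toInertiaCoinvariants 𝔓 ⟨σ, hσD⟩ =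
        ε • LinearMap.id := by
    rcases hε with ⟨hsp, rfl⟩ | ⟨hns, rfl⟩
    · rw [one_smul]
      exact (E.inertiaCoinvariants_rationalTate_of_hasSplitMultiplicativeReductionAt_holds p
        (continuous_rationalGaloisRepTate_holds E p) w hw hsp h𝔓).2 ⟨σ, hσD⟩
    · rw [neg_one_smul]
      exact (E.inertiaCoinvariants_rationalTate_of_hasNonsplitMultiplicativeReductionAt_holds p
        (continuous_rationalGaloisRepTate_holds E p) w hw hv hns h𝔓).2 ⟨σ, hσD⟩ hσ
  have hmk : Representation.Coinvariants.mk π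
      (rationalTateRepresentation (absoluteGaloisGroup K) (geomPoints E) p σ v) =
        ε • Representation.Coinvariants.mk π v := by
    have := LinearMap.congr_fun hscal (Representation.Coinvariants.mk π v)
    rw [ContinuousRep.toInertiaCoinvariants_mk, LinearMap.smul_apply, LinearMap.id_apply] at this
    exact this
  rw [← Representation.Coinvariants.mk_eq_zero, map_sub, map_smul, hmk, sub_self]

end Rational

/-! ## §2 Transfer to `T_p E` and `E[p^∞]` in the local currency (`absInertia K_w`, `localMap K (inl w)`) -/

section Local

variable {K : Type} [Field K] [NumberField K] (E : WeierstrassCurve K) [E.IsElliptic]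
  (p : ℕ) [Fact p.Prime] {w : HeightOneSpectrum (𝓞 K)}

/-- An element of the local inertia group lies, under `localMap K (inl w)`, in the inertia group of
`𝔓₀ = adicCompletionPrime K w` (`I_{𝔓₀} = res I_{K_w}`). [cite: NeukirchANT1999, Ch. II §9 Prop. (9.6)] -/
theorem localMap_mem_inertia_adicCompletionPrime {σ : absoluteGaloisGroup (w.adicCompletion K)}
    (hσ : σ ∈ absInertia (w.adicCompletion K)) :
    localMap K (Sum.inl w) σ ∈ (adicCompletionPrime K w).inertia (absoluteGaloisGroup K) := by
  rw [inertia_adicCompletionPrime_eq_map_absInertia]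
  exact Subgroup.mem_map_of_mem _ hσ

/-- Every element of `Γ_{K_w}` lies, under `localMap K (inl w)`, in the decomposition group of
`𝔓₀ = adicCompletionPrime K w` (`D_{𝔓₀} = res Γ_{K_w}`). [cite: NeukirchANT1999, Ch. II §9 Prop. (9.6)] -/
theorem localMap_mem_decompositionSubgroup_adicCompletionPrime
    (σ : absoluteGaloisGroup (w.adicCompletion K)) :
    localMap K (Sum.inl w) σ ∈ (adicCompletionPrime K w).decompositionSubgroup (absoluteGaloisGroup K) := by
  rw [decompositionSubgroup_adicCompletionPrime_eq_range]
  exact ⟨σ, rfl⟩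

/-- **`(τ − 1)(σ − 1) = 0` on `T_p E`** for `σ, τ` in the local inertia group at a multiplicative
`w ∤ p` (`T_p E ↪ V_p E`). [cite: SilvermanATAEC1994, Ex. 5.13 (b)] -/
theorem tateModule_inertia_smul_sub_eq
    (hw : ((p : ℕ) : 𝓞 K) ∉ w.asIdeal) (hv : E.HasMultiplicativeReductionAt w)
    {σ τ : absoluteGaloisGroup (w.adicCompletion K)} (hσ : σ ∈ absInertia (w.adicCompletion K))
    (hτ : τ ∈ absInertia (w.adicCompletion K)) (x : E.tateModule p) :
    localMap K (Sum.inl w) σ • (localMap K (Sum.inl w) τ • x - x) =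
      localMap K (Sum.inl w) τ • x - x := by
  apply TateModule.toRational_injective
  have h := rationalTate_inertia_smul_sub_eq E p hw hv (adicCompletionPrime_mem_primesAbove K w)
    (localMap_mem_inertia_adicCompletionPrime hσ) (localMap_mem_inertia_adicCompletionPrime hτ)
    (TateModule.toRational p x)
  rw [rationalTateRepresentation_toRational, ← map_sub, rationalTateRepresentation_toRational] at h
  exact h

/-- **`(τ − 1)(σ − 1) = 0` on `E[p^∞]`** for `σ, τ ∈ absInertia K_w` at a multiplicative `w ∤ p`, in
the currency `ρw = (primaryTorsionGaloisRep p).restrict (localMap K (inl w))` (every `p^n`-torsion point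
is a component of an element of `T_p E`, `proj_surjective_of_isAlgClosed_holds`). Equivalently: the
inertia group acts trivially on `E[p^∞]` modulo its invariants. [cite: SilvermanATAEC1994, Ex. 5.13 (b)] -/
theorem primaryTorsionGaloisRep_inertia_smul_sub_eq
    (hw : ((p : ℕ) : 𝓞 K) ∉ w.asIdeal) (hv : E.HasMultiplicativeReductionAt w)
    {σ τ : absoluteGaloisGroup (w.adicCompletion K)} (hσ : σ ∈ absInertia (w.adicCompletion K))
    (hτ : τ ∈ absInertia (w.adicCompletion K)) (a : PrimaryTorsion (geomPoints E) p) :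
    ((E.primaryTorsionGaloisRep p).restrict (localMap K (Sum.inl w)) :
      ContinuousRep (absoluteGaloisGroup (w.adicCompletion K)) ℤ_[p]
        (PrimaryTorsion (geomPoints E) p)) σ
      (((E.primaryTorsionGaloisRep p).restrict (localMap K (Sum.inl w)) :
        ContinuousRep (absoluteGaloisGroup (w.adicCompletion K)) ℤ_[p]
          (PrimaryTorsion (geomPoints E) p)) τ a - a) =
    ((E.primaryTorsionGaloisRep p).restrict (localMap K (Sum.inl w)) :
      ContinuousRep (absoluteGaloisGroup (w.adicCompletion K)) ℤ_[p]
        (PrimaryTorsion (geomPoints E) p)) τ a - a := by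
  obtain ⟨n, hn⟩ := a.exists_pow_smul_eq_zero
  have ha : (a : geomPoints E) ∈ geomTorsion E ((p ^ n : ℕ) : ℤ) := by
    rw [mem_geomTorsion_iff, natCast_zsmul]; exact hn
  obtain ⟨x, hx⟩ := proj_surjective_of_isAlgClosed_holds E p n ha
  apply PrimaryTorsion.ext
  change localMap K (Sum.inl w) σ • (localMap K (Sum.inl w) τ • (a : geomPoints E) - a) =
    localMap K (Sum.inl w) τ • (a : geomPoints E) - a
  rw [← hx, ← TateModule.proj_smul_of_distribMulAction, ← map_sub,
    ← TateModule.proj_smul_of_distribMulAction, tateModule_inertia_smul_sub_eq E p hw hv hσ hτ]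

/-- **The local inertia group acts non-trivially on `E[p^∞]`** at a multiplicative `w ∤ p`
(otherwise `I_{𝔓₀}` would act trivially on `T_p E` and `V_p E`, contradicting `codim (V_pE)^{I} = 1`).
[cite: SilvermanATAEC1994, Thm. IV.10.2(a) (multiplicative case: ε = 1)] -/
theorem exists_absInertia_primaryTorsionGaloisRep_ne
    (hw : ((p : ℕ) : 𝓞 K) ∉ w.asIdeal) (hv : E.HasMultiplicativeReductionAt w) :
    ∃ σ ∈ absInertia (w.adicCompletion K), ∃ a : PrimaryTorsion (geomPoints E) p,
      ((E.primaryTorsionGaloisRep p).restrict (localMap K (Sum.inl w)) :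
        ContinuousRep (absoluteGaloisGroup (w.adicCompletion K)) ℤ_[p]
          (PrimaryTorsion (geomPoints E) p)) σ a ≠ a := by
  by_contra hall
  push Not at hall
  haveI : FiniteDimensional ℚ_[p] (RationalTateModule (geomPoints E) p) := finite_rationalTateModule E p
  have hcodim := E.codimFixed_inertia_rationalTate_eq_one_of_hasMultiplicativeReductionAt_holds p
    (continuous_rationalGaloisRepTate_holds E p) w hw hv (adicCompletionPrime_mem_primesAbove K w)
  have h0 : (rationalTateGaloisRepOf (geomPoints E) p (continuous_rationalGaloisRepTate_holds E p)).codimFixed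
      ((adicCompletionPrime K w).inertia (absoluteGaloisGroup K)) = 0 := by
    refine ContinuousRep.codimFixed_eq_zero_of_forall_eq_one _ fun τ hτ => ?_
    rw [inertia_adicCompletionPrime_eq_map_absInertia] at hτ
    obtain ⟨σ, hσ, rfl⟩ := hτ
    -- `σ` fixes `T_p E`
    have hT : ∀ x : E.tateModule p, localMap K (Sum.inl w) σ • x = x := fun x => by
      refine TateModule.ext fun k => ?_
      rw [TateModule.proj_smul_of_distribMulAction]
      have hk : p ^ k • TateModule.proj p k x = 0 := TateModule.pow_smul_proj k x
      have := hall σ hσ (PrimaryTorsion.mk (TateModule.proj p k x) k hk)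
      exact congrArg PrimaryTorsion.val this
    -- hence `V_p E` (base change of the identity)
    have hT' : tateRepresentation (absoluteGaloisGroup K) (geomPoints E) p (localMap K (Sum.inl w) σ) = 1 :=
      LinearMap.ext hT
    change ((Module.End.baseChangeHom ℤ_[p] ℚ_[p] (E.tateModule p)).toMonoidHom.comp
      (tateRepresentation (absoluteGaloisGroup K) (geomPoints E) p)) (localMap K (Sum.inl w) σ) = 1
    rw [MonoidHom.comp_apply, hT', map_one]
  rw [h0] at hcodim
  exact zero_ne_one hcodim

/-- Clearing denominators: an element of the `ℚ_p`-span of the image of a `ℤ_p`-submodule `N` under a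
`ℤ_p`-linear map `ι` into a `ℚ_p`-space becomes an element of `ι(N)` after multiplication by a non-zero
`p`-adic integer. [folklore] -/
theorem exists_smul_mem_of_mem_span_image {T V : Type*} [AddCommGroup T] [Module ℤ_[p] T]
    [AddCommGroup V] [Module ℚ_[p] V] [Module ℤ_[p] V] [IsScalarTower ℤ_[p] ℚ_[p] V]
    (ι : T →ₗ[ℤ_[p]] V) (N : Submodule ℤ_[p] T) {z : V}
    (hz : z ∈ Submodule.span ℚ_[p] (ι '' (N : Set T))) :
    ∃ d : ℤ_[p], d ≠ 0 ∧ ∃ n ∈ N, d • z = ι n := by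
  induction hz using Submodule.span_induction with
  | mem x hx =>
    obtain ⟨n, hn, rfl⟩ := hx
    exact ⟨1, one_ne_zero, n, hn, by rw [one_smul]⟩
  | zero => exact ⟨1, one_ne_zero, 0, N.zero_mem, by rw [smul_zero, map_zero]⟩
  | add x y _ _ hx hy =>
    obtain ⟨d₁, hd₁, n₁, hn₁, h₁⟩ := hx
    obtain ⟨d₂, hd₂, n₂, hn₂, h₂⟩ := hy
    refine ⟨d₁ * d₂, mul_ne_zero hd₁ hd₂, d₂ • n₁ + d₁ • n₂,
      N.add_mem (N.smul_mem _ hn₁) (N.smul_mem _ hn₂), ?_⟩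
    rw [smul_add, map_add, map_smul, map_smul, ← h₁, ← h₂, smul_smul, smul_smul, mul_comm d₂ d₁]
  | smul c x _ hx =>
    obtain ⟨d, hd, n, hn, h⟩ := hx
    obtain ⟨⟨a, s⟩, hs⟩ := IsLocalization.surj (nonZeroDivisors ℤ_[p]) c
    refine ⟨d * s, mul_ne_zero hd (nonZeroDivisors.ne_zero s.2), a • n, N.smul_mem _ hn, ?_⟩
    have hs' : c * algebraMap ℤ_[p] ℚ_[p] (s : ℤ_[p]) = algebraMap ℤ_[p] ℚ_[p] a := hs
    rw [map_smul, ← h, mul_smul, ← algebraMap_smul ℚ_[p] (s : ℤ_[p]) (c • x), smul_smul, mul_comm, hs',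
      algebraMap_smul, smul_comm]

/-- **Frobenius ≡ ε on `T_p E` modulo inertia differences, integrally.** At a multiplicative `w ∤ p`, for
a local Frobenius `φ` (`IsFrobPow φ 1`) and `x ∈ T_p E`: some non-zero `p`-adic multiple of
`φ·x − ε·x` (`ε = 1` split, `ε = −1` non-split) lies in the `ℤ_p`-span of
`{τ·y − y : τ ∈ absInertia K_w, y ∈ T_p E}`.
[cite: SilvermanATAEC1994, Thm. V.5.3, Lemma V.5.2 (c), Ex. 5.11 (b), Ex. 5.13 (a)]
[cite: GreenbergVatsal2000, §2, proof of Prop. 2.4 (arXiv p. 22)] -/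
theorem exists_smul_frob_sub_smul_mem_span
    (hw : ((p : ℕ) : 𝓞 K) ∉ w.asIdeal) (hv : E.HasMultiplicativeReductionAt w)
    {φ : absoluteGaloisGroup (w.adicCompletion K)} (hφ : IsFrobPow φ 1) {ε : ℤ_[p]}
    (hε : (E.HasSplitMultiplicativeReductionAt w ∧ ε = 1) ∨
      (¬ E.HasSplitMultiplicativeReductionAt w ∧ ε = -1))
    (x : E.tateModule p) :
    ∃ d : ℤ_[p], d ≠ 0 ∧ d • (localMap K (Sum.inl w) φ • x - ε • x) ∈
      Submodule.span ℤ_[p] {y : E.tateModule p | ∃ τ ∈ absInertia (w.adicCompletion K),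
        ∃ x' : E.tateModule p, y = localMap K (Sum.inl w) τ • x' - x'} := by
  set N : Submodule ℤ_[p] (E.tateModule p) := Submodule.span ℤ_[p] {y : E.tateModule p |
    ∃ τ ∈ absInertia (w.adicCompletion K), ∃ x' : E.tateModule p, y = localMap K (Sum.inl w) τ • x' - x'}
    with hN
  have hε' : (E.HasSplitMultiplicativeReductionAt w ∧ ((ε : ℤ_[p]) : ℚ_[p]) = 1) ∨
      (¬ E.HasSplitMultiplicativeReductionAt w ∧ ((ε : ℤ_[p]) : ℚ_[p]) = -1) := by
    rcases hε with ⟨h, rfl⟩ | ⟨h, rfl⟩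
    · exact Or.inl ⟨h, by rw [PadicInt.coe_one]⟩
    · exact Or.inr ⟨h, by rw [PadicInt.coe_neg, PadicInt.coe_one]⟩
  have hmem := rationalTate_frob_sub_smul_mem_coinvariantsKer E p hw hv
    (adicCompletionPrime_mem_primesAbove K w) (localMap_mem_decompositionSubgroup_adicCompletionPrime φ)
    (isArithFrobAt_localMap_of_isFrobPow hφ) hε' (TateModule.toRational p x)
  -- the coinvariant kernel lies in the `ℚ_p`-span of `ι(N)`
  have hker : Representation.Coinvariants.ker
      (((rationalTateGaloisRepOf (geomPoints E) p (continuous_rationalGaloisRepTate_holds E p)).restrictDecomposition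
        (adicCompletionPrime K w)).comp
        ((adicCompletionPrime K w).inertia ((adicCompletionPrime K w).decompositionSubgroup
          (absoluteGaloisGroup K))).subtype) ≤
      Submodule.span ℚ_[p] (TateModule.toRational p '' (N : Set (E.tateModule p))) := by
    rw [Representation.Coinvariants.ker, Submodule.span_le]
    rintro _ ⟨⟨s, v⟩, rfl⟩
    have hsI : ((s : (adicCompletionPrime K w).decompositionSubgroup (absoluteGaloisGroup K)) :
        absoluteGaloisGroup K) ∈ (adicCompletionPrime K w).inertia (absoluteGaloisGroup K) :=
      Ideal.coe_mem_inertia.mpr s.2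
    rw [inertia_adicCompletionPrime_eq_map_absInertia] at hsI
    obtain ⟨τ, hτ, hτs⟩ := hsI
    change rationalTateRepresentation (absoluteGaloisGroup K) (geomPoints E) p
      ((s : (adicCompletionPrime K w).decompositionSubgroup (absoluteGaloisGroup K)) : absoluteGaloisGroup K) v - v ∈ _
    rw [← hτs]
    -- the `ℚ_p`-linear map `v ↦ ρ(τ)v − v` takes pure tensors into the span, hence everything
    set L : RationalTateModule (geomPoints E) p →ₗ[ℚ_[p]] RationalTateModule (geomPoints E) p :=
      rationalTateRepresentation (absoluteGaloisGroup K) (geomPoints E) p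
        ((absGaloisRestrict K (w.adicCompletion K)).toMonoidHom τ) - LinearMap.id with hL
    change L v ∈ Submodule.span ℚ_[p] (TateModule.toRational p '' (N : Set (E.tateModule p)))
    have hrange : LinearMap.range L ≤
        Submodule.span ℚ_[p] (TateModule.toRational p '' (N : Set (E.tateModule p))) := by
      have htop : (⊤ : Submodule ℚ_[p] (RationalTateModule (geomPoints E) p)) =
          Submodule.span ℚ_[p] (Set.range (TateModule.toRational p (A := geomPoints E))) := by
        apply le_antisymm _ le_top
        rintro v -
        induction v using TensorProduct.induction_on with
        | zero => exact Submodule.zero_mem _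
        | tmul c y =>
          have : ((c ⊗ₜ[ℤ_[p]] y : ℚ_[p] ⊗[ℤ_[p]] E.tateModule p) : RationalTateModule (geomPoints E) p) =
              c • TateModule.toRational p y := by
            rw [TateModule.toRational_apply]
            change (c ⊗ₜ[ℤ_[p]] y : ℚ_[p] ⊗[ℤ_[p]] E.tateModule p) =
              c • ((1 : ℚ_[p]) ⊗ₜ[ℤ_[p]] y : ℚ_[p] ⊗[ℤ_[p]] E.tateModule p)
            rw [TensorProduct.smul_tmul', smul_eq_mul, mul_one]
          rw [this]
          exact Submodule.smul_mem _ _ (Submodule.subset_span ⟨y, rfl⟩)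
        | add u v hu hv' => exact Submodule.add_mem _ hu hv'
      rw [LinearMap.range_eq_map, htop, Submodule.map_span, Submodule.span_le]
      rintro _ ⟨_, ⟨y, rfl⟩, rfl⟩
      have : L (TateModule.toRational p y) = TateModule.toRational p (localMap K (Sum.inl w) τ • y - y) := by
        rw [hL, LinearMap.sub_apply, LinearMap.id_apply, rationalTateRepresentation_toRational, map_sub]
        rfl
      rw [this]
      exact Submodule.subset_span ⟨_, Submodule.subset_span ⟨τ, hτ, y, rfl⟩, rfl⟩
    exact hrange (LinearMap.mem_range_self L v)
  have hz : TateModule.toRational p (localMap K (Sum.inl w) φ • x - ε • x) ∈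
      Submodule.span ℚ_[p] (TateModule.toRational p '' (N : Set (E.tateModule p))) := by
    refine hker ?_
    have e1 : ((ε : ℤ_[p]) : ℚ_[p]) • TateModule.toRational p x = ε • TateModule.toRational p x :=
      algebraMap_smul ℚ_[p] ε (TateModule.toRational p x)
    rw [map_sub, ← rationalTateRepresentation_toRational, map_smul, ← e1]
    exact hmem
  obtain ⟨d, hd, n, hn, h⟩ := exists_smul_mem_of_mem_span_image p (TateModule.toRational p) N hz
  refine ⟨d, hd, ?_⟩
  have : TateModule.toRational p (d • (localMap K (Sum.inl w) φ • x - ε • x)) = TateModule.toRational p n := by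
    rw [map_smul]; exact h
  rw [TateModule.toRational_injective this]
  exact hn

end Local

end Summit.BirchSwinnertonDyer.BirchSwinnertonDyer.Theorems.SigmaLocal

end
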